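import Summits.QuantumFields.YangMills.Theorems.BalabanUVNodesPortS1FHInterfaceRecord
import Summits.QuantumFields.YangMills.Theorems.BalabanUVNodesPortS1Sigma0Cubes
import Summits.QuantumFields.YangMills.Theorems.BalabanUVNodesPortS1FWPieces
import Summits.QuantumFields.YangMills.Theorems.BalabanUVNodesPortS1FWLettersAtRecord
import Literature.MathematicalPhysics.QuantumFieldTheory.Balaban1983to89.Node00.BgCarriersOfRecordLit

/-!
# Port S₁ of ⟨stmt-QuantumFields-27930⟩ — the letter (D-loc): «`H₀(U)` is a sum of cube-localized, U-local pieces» (LEAF DEF; ★★★ director-ym №681 (2))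

The S₃ node-A memo of record (◇ LENS-1 g18 v27.9 `nodeO-cover/LENS1g18S3AssemblyV279.lean` ba54e32c37960361, ◆ CRIT-1 g41 cut 2026-08-31T23:17Z) discharges the
`H₀`-rows of the (C-FW)⁺ package (fields `fam.H₀s`, rows `localH₀`, the `H₀`-third of the (1.6) construction, the port pin `pinH₀`, the `H₀`-conjunct of U-locality (L3))
from ONE letter, `RecordH1LocalPieces F Ms κ₁ B₀ εFW`, by finite algebra (`h0Rows_of_localPieces`, in the memo).  This leaf DECLARES that letter once, in the tree, so that the memo
(v27.10 on) IMPORTS it (declare-once) — together with the two σ₀-cube proximity words it is spelled in (`Near`, `FineAgreeNear`).  Nothing else: NOT the package, NOT `FWSupply`,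
NOT node A.

MATHEMATICAL CONTENT OF THE LETTER ([B9] = Bałaban, *Propagators for lattice gauge theories in a background field*, CMP 99 (1985), (3.107)–(3.108) p.416 with the random-walk
representation of §3; [15] = Bałaban, *The variational problem …*, CMP 102 (1985), (174) p.305 `H₀ = (−Δ_a)⁻¹Q*…`; [II] = Bałaban, *Renormalization group approach … II*,
CMP 116 (1988), (1.6)–(1.7) p.3, (1.11) p.5, p.3 L14–16): at ABSOLUTE `(Ms, κ₁, B₀, εFW)`, for every guarded level pair `k ≤ K` and every record datum `(Ω, levB)`,
`H₀(U) = Σ_ω T_ω(U)` — finitely many pieces with CONNECTED σ₀-cube supports (common wall), which (i) cover the cubes of both arguments and are summable in the (77)∕(115)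
operator norm with weight `e^{κ₁|supp ω|}` at print's constant `B₀e^{16κ₁}`; (ii) are U-LOCAL: fine configurations agreeing near `supp ω` give the same coordinate shadow of
`T_ω`; (iii) at the record configuration `U = UkSel F 2 K k εbg Vk` of a guarded `Vk`, the shadow of `Σ_ω T_ω` on real traceless block fields is the port letter
✓`recordH1 F k K εbg Vk` (= `H₁` of [15] (103)∕(174), the B-slot of the LANDAU representation — RR-2 READ 24 ∕ ★★★ №679 (3)).

SCOPE (◆ CRIT-1 g41 observation O-1): (i)'s summability and (ii)'s locality range over ALL fine configurations `U, U′` (the guard is on `εbg` only), (iii) at the record datum only.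
This is stronger than print's class-wise statement but satisfiable by LOCAL DEFINABILITY: off the small-field class the supplier serves print's localized pieces wherever they are
locally defined near `supp ω` ([B9] p.394: the localized operators «depend on the configuration U restricted to Ω₀», a local condition that `FineAgreeNear` transports) and `0`
elsewhere; `Ms` (∃-bound before everything else by the consumer `FWSupply`) is taken at least print's localization collar, so that `FineAgreeNear`'s one-adjacent-cube
thickness covers it.

STATUS: a `def … : Prop` — OPEN, inhabited nowhere.  Supplier: the random-walk expansion of [B9] §3 + Thm 3.12 at guarded data (the same expansion that yields (C-FW)⁺; ★★★ №681 (3):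
its seat is joined to the K0ᴬ {W2} road decision).  Consumer: node A's `h0Rows_of_localPieces` (memo) and, through it, `FWSupply`'s `H₀`-slot.

[cite: Balaban1985BackgroundPropagators, (3.107)–(3.108) p.416, p.394 L31–33; Balaban1988RG2Cluster, (1.6)–(1.7) p.3, (1.11) p.5, p.3 L14–17; Balaban1985Variational, (174) p.305]
-/

open scoped BigOperators Matrix.Norms.L2Operator

namespace Summit.QuantumFields.YangMills.Theorems.BalabanUVNodesPortS1

open Summit.QuantumFields.YangMills.Theorems.K0RecordFormatNames
open Summit.QuantumFields.YangMills.Theorems.BalabanUVNodesPortS1.FHInterface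
open Literature.MathematicalPhysics.QuantumFieldTheory.Balaban1983to89
open Literature.MathematicalPhysics.QuantumFieldTheory.Balaban1983to89.Node00
open Literature.MathematicalPhysics.QuantumFieldTheory.Balaban1983to89.T4Continuum (T4Family)
open Literature.MathematicalPhysics.QuantumFieldTheory.Balaban1983to89.B11Eq115Space (NegSize)
open Summit.QuantumFields.YangMills.Theorems.BalabanUVNodesPortS1.FWPieces (Covers SuppConnected CubeFaceAdj)

/-- «`a` is `b` or shares a wall with it». [cite: Balaban1988RG2Cluster, p.3 L14–17 (bookkeeping)] -/
def Near {σ : Type*} (Adj : σ → σ → Prop) (a b : σ) : Prop := a = b ∨ Adj a b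

/-- **«Two FINE configurations AGREE NEAR the cube `Δ`»** — on every fine bond whose cube is `Δ` or shares a wall with it (the thick neighbourhood in which an object
localized at `Δ` reads the configuration, p.3 L14–17 «its kernel vanishes in a sufficiently thick neighborhood of ∂X_i»).  ◆ C-1: the carrier is `GaugeField (F.P K) 0`,
print's `U_k`; v27.7 (◆ C-5): spelled through def-Y's ✓`cubeOfFineIdx F Ms k K p` over `p : FineIdx F K = PBond × Fin 3` (colour-blind, each bond thrice) — ONE σ₀ home.
[cite: Balaban1988RG2Cluster, p.3 L14–17; Balaban1985BackgroundPropagators, (3.107)–(3.108) p.416] -/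
def FineAgreeNear (F : T4Family) (Ms k K : ℕ) (Δ : CubeIdxAt F Ms k K) (U U' : GaugeField (F.P K) 0 (SU 2)) : Prop :=
  ∀ p : FineIdx F K, Near CubeFaceAdj (cubeOfFineIdx F Ms k K p) Δ → U p.1 = U' p.1

/-- **(D-loc) — «`H₀(U)` is a sum of cube-localized, U-local pieces, summable with weight `e^{κ₁|supp ω|}`», at ABSOLUTE `(Ms, κ₁, B₀, εFW)`, for every guarded level pair and
every record datum `(Ω, levB)`: finitely many pieces `T_ω(εbg, U) : 𝔅 →L[ℂ] Space115Lit … U` with CONNECTED cube supports (common wall), which at every admissible `εbg`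
(i) COVER the cubes of both arguments (read on the shadows, ✓`FWPieces.Covers`) and are SUMMABLE in the 115 operator norm with print's constant `B₀e^{16κ₁}` ((1.7)∕(1.11));
(ii) are U-LOCAL on shadows: configurations agreeing near `supp ω` give the same shadow of `T_ω`; (iii) at the record configuration `U = UkSel F 2 K k εbg Vk` of a guarded `Vk`
the shadow of `Σ_ω T_ω` restricted to real traceless block fields is ✓`recordH1 F k K εbg Vk` (print's `H₀ = Σ_ω H₀(ω)`, [13] (3.107) for `G` and the representation (174)
`H₀ = (−Δ_a)⁻¹Q*…`).  SCOPE (◆ O-1, v27.10): (i)'s summability and (ii)'s locality range over ALL `U` (guard on `εbg` only), (iii) at the record datum only — off the class the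
supplier serves the localized pieces where locally defined near `supp ω` and `0` elsewhere (local definability, [B9] p.394), so (i)(ii) hold for all pairs and trivially off the class.
Supplier: FW-1 (the random-walk expansion [13] §3 + [14]).  OPEN; inhabited nowhere. [cite: Balaban1985BackgroundPropagators, (3.107)–(3.108) p.416;
Balaban1988RG2Cluster, (1.6)–(1.7) p.3, (1.11) p.5, p.3 L14–16; Balaban1985Variational, (174) p.305] -/
def RecordH1LocalPieces (F : T4Family) (Ms : ℕ) (κ₁ B₀ εFW : ℝ) : Prop :=
  ∀ k K : ℕ, k ≤ K →
    haveI := factL F; haveI := factEta F K k; haveI := factC0 F K k; haveI := wBRec_fact F K k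
    ∀ (Ω : ℕ → Set (Site (F.P K) 0)), (∀ x, x ∈ Ω k) → ∀ (levB : PBond (F.P K) k → ℕ),
      ∃ (n : ℕ) (supp : Fin n → Finset (CubeIdxAt F Ms k K))
        (piece : ℝ → (U : GaugeField (F.P K) 0 (SU 2)) → Fin n →
          (NegSize (F.L : ℝ) ((F.P K).eta k) levB 0 (Matrix (Fin 2) (Fin 2) ℂ) →L[ℂ] Space115Lit F 2 K k Ω U)),
        (∀ ω, SuppConnected CubeFaceAdj (supp ω)) ∧
        ∀ εbg : ℝ, 0 < εbg → εbg ≤ εFW →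
          (∀ U : GaugeField (F.P K) 0 (SU 2),
              Covers (cubeOfFluctIdx F Ms k k K) (cubeOfFineIdx F Ms k K) supp (fun ω => recordHfwOfH F K k Ω U levB (piece εbg U ω)) ∧
              ∑ ω, ‖piece εbg U ω‖ * Real.exp κ₁ ^ (supp ω).card ≤ B₀ * Real.exp (16 * κ₁)) ∧
          (∀ (U U' : GaugeField (F.P K) 0 (SU 2)) (ω : Fin n), (∀ Δ ∈ supp ω, FineAgreeNear F Ms k K Δ U U') →
              recordHfwOfH F K k Ω U levB (piece εbg U ω) = recordHfwOfH F K k Ω U' levB (piece εbg U' ω)) ∧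
          (∀ Vk : GaugeField (F.P K) k (SU 2), PlaqSmall εbg Vk → ∀ x : FluctIdx F k K → ℝ,
              recordHfwOfH F K k Ω (UkSel F 2 K k εbg Vk) levB (∑ ω, piece εbg (UkSel F 2 K k εbg Vk) ω) (fluctRealEmb F k K x) =
                fineRealEmb F K (recordH1 F k K εbg Vk x))

end Summit.QuantumFields.YangMills.Theorems.BalabanUVNodesPortS1
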